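import Literature.NumberTheory.Transcendental.RoySmallValuePhiMult
import Literature.NumberTheory.Transcendental.RoySmallValueSelectionLemma
import HarnessLib

/-!
# Roy's small value estimate for `𝔾ₐ × 𝔾ₘ` — Proposition 6.1 for the determinant `Φ`

Topic `Literature/NumberTheory/Transcendental`. Part of the formalisation of the proof of Roy 2013,
Theorem 1.1 (named fact `roy2013_thm_1_1`, `RoySmallValueEstimates.lean`). Source: D. Roy,
*A small value estimate for `𝔾ₐ × 𝔾ₘ`*, Mathematika 59 (2013) 333–363 = arXiv:1301.0663, §6,
Proposition 6.1 and its proof (p. 16 of the arXiv text):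

> **Proposition 6.1.** Let `D, T ∈ ℕ*` and `Y, U > 0` with `T ≤ binom(D+1, 2)` and
> `2T log(c₆) ≤ Y` [...]. Then, for `𝒞 = {P ∈ ℂ[X]_D ; ‖P‖ ≤ e^Y, max_{i<T} |𝒟ⁱP(1,ξ,η)| ≤ e^{-U}}`,
> we have `h_𝒞(ℙ²) ≤ −TU + 3D²Y + 21 log(3) D³`.

The printed proof bounds `|Res_D(P₀, P₁, P₂)|` for `Pⱼ ∈ 𝒞`: with `Qⱼ ∈ ℂ[X]_L` interpolating the
first `T` values `𝒟ⁱPⱼ(1, γ)` (Proposition 3.3), `Pⱼ − X₀^{D−L}Qⱼ ∈ I^{(γ,T)}`, so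
`f(z) = Res_D(Pⱼ − (1−z)X₀^{D−L}Qⱼ)` vanishes to order `T` at `0` (Corollary 5.7) and the Schwarz
lemma gives `|f(1)| ≤ e^{−TU} sup_{|z|=e^U} |f| ≤ e^{−TU} sup{|Res_D(P')| : ‖P'ⱼ‖ ≤ 3e^Y}`.
We run exactly this argument for the determinant `Φ = royPhi` of the proof of Theorem 5.2 (which
replaces `Res_D` throughout this development), using `royPhi_line_multiplicity` for Corollary 5.7
and `norm_royPhi_le` for the final size bound:

* (the Schwarz lemma for polynomials, `z^T ∣ p ⇒ |p(1)| ≤ R^{−T} sup_{|z| = R} |p|`, is the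
  tree's `norm_eval_one_le_of_X_pow_dvd` of `RoySmallValueSelectionLemma`);
* `prop_6_1` — for `Pⱼ ∈ 𝒞` (`j = 0, 1, 2`):
  `|Φ(P₀, P₁, P₂)| ≤ e^{−TU} · N! · (3e^Y)^N`, `N = binom(3D+2, 2)`, under `T ≤ binom(L+2, 2)`,
  `L ≤ D` and `c₁'^L (4(L+1))^{binom(L+2,2)} ≤ e^Y` (our form of `2T log c₆ ≤ Y`; the constants of
  our Proposition 3.3 differ from the printed ones, see `RoySmallValueInterpolation.lean`).

Everything here is proved; no new definitions, no named facts.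

## References

* [Roy2013] D. Roy, *A small value estimate for 𝔾ₐ × 𝔾ₘ*, Mathematika 59 (2013), 333–363
  (arXiv:1301.0663), §6, Proposition 6.1.
-/

noncomputable section

open MvPolynomial Finset Module Matrix

namespace Literature.NumberTheory.Transcendental

namespace Roy2013

open Nesterenko

variable {D : ℕ} {M₁ M₂ : Finset (Fin 3 →₀ ℕ)}

/-! ### Proposition 6.1 for `Φ` -/

/-- `X₀^m Q ∈ ℂ[X]_{m+L}` for `Q ∈ ℂ[X]_L`. [folklore] -/
theorem isHomogeneous_X_zero_pow_mul {Q : CX} {L : ℕ} (hQ : Q.IsHomogeneous L) (m : ℕ) :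
    (X 0 ^ m * Q).IsHomogeneous (m + L) := by
  have h := ((isHomogeneous_X ℂ (0 : Fin 3)).pow m).mul hQ
  rwa [one_mul] at h

/-- **Roy 2013, Proposition 6.1 (for `Φ`).** Let `γ = (ξ, η)` with `η ≠ 0`, `T ≤ binom(L+2, 2)`,
`L ≤ D`, `U ≥ 0`, and `c₁'^L (4(L+1))^{binom(L+2,2)} ≤ e^Y` (`c₁' = 3(1+|ξ|+|η|⁻¹)`). If
`P₀, P₁, P₂ ∈ ℂ[X]_D` satisfy `‖Pⱼ‖ ≤ e^Y` and `|𝒟ⁱPⱼ(1, ξ, η)| ≤ e^{−U}` for `i < T` (i.e.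
`Pⱼ ∈ 𝒞`), then `|Φ(P₀, P₁, P₂)| ≤ e^{−TU} · N! · (3e^Y)^N` with `N = binom(3D+2, 2)` the size of the
matrix of `Φ`. (Printed: `h_𝒞(ℙ²) ≤ −TU + 3D²Y + 21 log(3) D³` for `Res_D`; here `Res_D` is replaced
by `Φ` and `e^{h_𝓑}` by the crude bound `N! (3e^Y)^N` of `norm_royPhi_le`.)
[cite: Roy2013, Proposition 6.1] -/
theorem prop_6_1 {ξ η : ℂ} (hη : η ≠ 0) {T L : ℕ} (hTL : T ≤ (L + 2).choose 2) (hLD : L ≤ D)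
    {Y U : ℝ} (hU : 0 ≤ U)
    (hY : (3 * (1 + ‖ξ‖ + ‖η‖⁻¹)) ^ L * (4 * (L + 1) : ℝ) ^ (L + 2).choose 2 ≤ Real.exp Y)
    (hM₁ : ∀ μ ∈ M₁, μ.degree = 2 * D) (hM₂ : ∀ μ ∈ M₂, μ.degree = 2 * D)
    (σ : (↥(finsuppAntidiag (univ : Finset (Fin 3)) (2 * D)) ⊕ (↥M₁ ⊕ ↥M₂)) ≃
      ↥(finsuppAntidiag (univ : Finset (Fin 3)) (3 * D)))
    {Ps : Fin 3 → CX} (hPh : ∀ j, (Ps j).IsHomogeneous D)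
    (hPn : ∀ j, maxNorm (Ps j) ≤ Real.exp Y)
    (hPv : ∀ j, ∀ i < T, ‖aeval ![1, ξ, η] (homD^[i] (Ps j))‖ ≤ Real.exp (-U)) :
    ‖royPhi D M₁ M₂ σ Ps‖ ≤ Real.exp (-(T * U)) *
      ((Fintype.card ↥(finsuppAntidiag (univ : Finset (Fin 3)) (3 * D))).factorial *
        (3 * Real.exp Y) ^ Fintype.card ↥(finsuppAntidiag (univ : Finset (Fin 3)) (3 * D))) := by
  classical
  set K : ℝ := (3 * (1 + ‖ξ‖ + ‖η‖⁻¹)) ^ L * (4 * (L + 1) : ℝ) ^ (L + 2).choose 2 with hK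
  -- Step 1: the interpolating forms `Q_j ∈ ℂ[X]_L`
  have hQ : ∀ j : Fin 3, ∃ Q : CX, Q.IsHomogeneous L ∧
      (∀ n < (L + 2).choose 2, aeval ![1, ξ, η] (homD^[n] Q) =
        if n < T then aeval ![1, ξ, η] (homD^[n] (Ps j)) else 0) ∧
      l1Norm Q ≤ K * Real.exp (-U) := fun j =>
    exists_isHomogeneous_iterate_homD_eq_of_norm_le L hη _ fun n _ => by
      split_ifs with h
      · exact hPv j n h
      · rw [norm_zero]; exact (Real.exp_pos _).le
  choose Q hQh hQv hQn using hQ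
  set Rs : Fin 3 → CX := fun j => X 0 ^ (D - L) * Q j with hRs
  set Qs₀ : Fin 3 → CX := fun j => Ps j - Rs j with hQs₀
  have hRh : ∀ j, (Rs j).IsHomogeneous D := fun j => by
    have h := isHomogeneous_X_zero_pow_mul (hQh j) (D - L)
    rwa [Nat.sub_add_cancel hLD] at h
  have hQs₀h : ∀ j, (Qs₀ j).IsHomogeneous D := fun j => (hPh j).sub (hRh j)
  have hQs₀v : ∀ j, Qs₀ j ∈ vanIdeal ξ η T := fun j => mem_vanIdeal_iff.mpr fun i hi => by
    change aeval ![1, ξ, η] (homD^[i] (Ps j - X 0 ^ (D - L) * Q j)) = 0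
    rw [iterate_homD_sub, map_sub, iterate_homD_X_zero_pow_mul, aeval_one_X_zero_pow_mul,
      hQv j i (lt_of_lt_of_le hi hTL), if_pos hi, sub_self]
  -- Step 2: the line `z ↦ Φ(P_j − (1 − z) X₀^{D−L} Q_j)` vanishes to order `T` at `0`
  have hT3 : T ≤ (3 * D + 2).choose 2 := hTL.trans (Nat.choose_le_choose 2 (by omega))
  obtain ⟨p, hpdvd, hpeval⟩ := royPhi_line_multiplicity hη hT3 hM₁ hM₂ σ hQs₀h hQs₀v Rs
  have hPs : Ps = Qs₀ + (1 : ℂ) • Rs := by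
    funext j; simp [hQs₀]
  -- Step 3: size on the circle `|z| = e^U`
  have hK0 : 0 ≤ K := by rw [hK]; positivity
  have hU1 : Real.exp (-U) ≤ 1 := Real.exp_le_one_iff.mpr (neg_nonpos.mpr hU)
  have hcirc : ∀ z : ℂ, ‖z‖ = Real.exp U → ‖p.eval z‖ ≤
      (Fintype.card ↥(finsuppAntidiag (univ : Finset (Fin 3)) (3 * D))).factorial *
        (3 * Real.exp Y) ^ Fintype.card ↥(finsuppAntidiag (univ : Finset (Fin 3)) (3 * D)) := by
    intro z hz
    rw [← hpeval]
    refine norm_royPhi_le σ _ fun j => ?_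
    rw [Pi.add_apply, Pi.smul_apply]
    change maxNorm (Ps j - Rs j + z • Rs j) ≤ 3 * Real.exp Y
    have hR : maxNorm (Rs j) ≤ K * Real.exp (-U) :=
      ((maxNorm_le_l1Norm _).trans (l1Norm_X_pow_mul_le 0 (D - L) (Q j))).trans (hQn j)
    have hz1 : ‖z - 1‖ ≤ Real.exp U + 1 := by
      refine (norm_sub_le _ _).trans ?_; rw [hz, norm_one]
    calc maxNorm (Ps j - Rs j + z • Rs j) = maxNorm (Ps j + C (z - 1) * Rs j) := by
          congr 1; rw [smul_eq_C_mul, map_sub, C_1]; ring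
      _ ≤ maxNorm (Ps j) + ‖z - 1‖ * maxNorm (Rs j) := by
          refine (maxNorm_add_le _ _).trans ?_; rw [maxNorm_C_mul]
      _ ≤ Real.exp Y + (Real.exp U + 1) * (K * Real.exp (-U)) :=
          add_le_add (hPn j) (mul_le_mul hz1 hR (maxNorm_nonneg _) (by positivity))
      _ = Real.exp Y + K * (1 + Real.exp (-U)) := by
          rw [show (Real.exp U + 1) * (K * Real.exp (-U)) =
            K * (Real.exp U * Real.exp (-U) + Real.exp (-U)) by ring, ← Real.exp_add,
            add_neg_cancel, Real.exp_zero]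
      _ ≤ Real.exp Y + K * 2 :=
          add_le_add le_rfl
            (mul_le_mul_of_nonneg_left (show 1 + Real.exp (-U) ≤ (2 : ℝ) by linarith) hK0)
      _ ≤ 3 * Real.exp Y := by linarith [hY]
  -- Step 4: Schwarz
  rw [hPs, hpeval]
  have h := norm_eval_one_le_of_X_pow_dvd hpdvd (Real.one_le_exp hU) fun z hz => hcirc z hz
  refine h.trans (le_of_eq ?_)
  rw [← Real.exp_nat_mul, div_eq_mul_inv, ← Real.exp_neg, mul_comm]

end Roy2013

end Literature.NumberTheory.Transcendental
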